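import Summits.HodgeConjecture.HodgeConjecture.Theorems.MarkmanPartnerTransportPicardThreeK3SquaresVarescoK3SimilitudeHolds
import Summits.HodgeConjecture.HodgeConjecture.Theorems.NikulinTwinTransportHodgeSimilitudeAlgebraicTranscendental
import Summits.HodgeConjecture.HodgeConjecture.Theorems.NikulinTwinTransportAlgebraicClassesOneOneK3Proof
import Summits.HodgeConjecture.HodgeConjecture.Theorems.NikulinTwinTransportLefschetzOneOneK3Closing
import Literature.AlgebraicGeometry.HodgeTheory.HodgeIndexPrimitiveAlgebraicHolds
import Literature.AlgebraicGeometry.Surfaces.K3HodgeTypesHolds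

/-!
# Route NikulinTwinTransport · crux `HodgeSimilitudeAlgebraic` (stmt-HodgeConjecture-13676) and target X
# `TwinSimilitudeAlgebraic` (stmt-HodgeConjecture-13674) GRANTED KUGA–SATAKE FOR ALL PROJECTIVE K3 SURFACES

The crux of route NikulinTwinTransport — every rational Hodge similitude of positive rational multiplier
between `H²` of projective K3 surfaces is algebraic, ALL multipliers — is "known in print only under the
Kuga–Satake Hodge conjecture" (its docstring: Varesco 2023 §0.3, Thm. 3). Varesco's theorem is now a
THEOREM OF THE TREE (`MarkmanPartnerTransport.KugaSatakePair.varesco2023_transcendentalHodgeSimilitude_algebraic_of_kugaSatake_K3_holds`,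
proved from the Kuga–Satake statements for the two surfaces alone, seat hodge-nonav-19652-p1 gen 15),
and the route holds the TRANSCENDENTAL REDUCTION of its crux
(`hodgeSimilitudeAlgebraic_of_forall_ratTransTwinTransportAt`: it suffices that on every twin pair of
marked K3 surfaces of every rational `c`-similitude `M` of `Λ_{K3}`, some algebraic class induce
`ψ = η⁻¹ ∘ M ∘ η′` on the transcendental classes and carry `N¹H²(S′)` into `N¹H²(S)`). This file joins
the two:

* `exists_corr_of_isAlgebraicCorrespondence₂` — an algebraic correspondence `H²(S′) → H²(S)` between
  two smooth projective surfaces is `[γ]_*` for an algebraic `γ` and ANY orientation family `μ`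
  (two-surface form of `SymplecticLocus.exists_corr_of_isAlgebraicCorrespondence`);
* `transc_markingConj` — a twin similitude `ψ = η⁻¹ ∘ M ∘ η′` (rational `M` with rational inverse,
  non-zero multiplier, periods to periods) carries `T(S′)` into `T(S)` (its inverse carries `N¹H²(S)`
  into `N¹H²(S′)`, `markingConj_mem_algebraicClasses`);
* `ratTransTwinTransportAt_of_kugaSatake` — **granted `IsKSCorrespondenceAlgebraicBetti` for every
  projective K3 surface, transcendental twin transport holds at every rational multiplier `c > 0`**
  (the two-surface Kuga–Satake theorem `KugaSatakePair.exists_algebraicCorrespondence_eq_of_similitude_of_kugaSatake₂`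
  applied to `ψ ∘ Q′`, `Q′` the rational transcendental projector of `S′`);
* `hodgeSimilitudeAlgebraic_of_kugaSatake` — **THE CRUX `HodgeSimilitudeAlgebraic` (all multipliers)
  from Kuga–Satake for all projective K3 surfaces**, modulo the marking fact
  `Huybrechts_K3_marking_exists` only (the Hodge types of `H²(K3)`, the Hodge index theorem, Lefschetz
  `(1,1)` and `AlgebraicClassesOneOneK3` are theorems of the tree);
* `twinSimilitudeAlgebraic_of_kugaSatake`, `hodgeIsometryAlgebraic_of_kugaSatake` — the route's target X
  (13674) and Buskin's item (13675) likewise (the latter WITHOUT Buskin's theorem as input).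

CONDITIONAL on the Kuga–Satake statements (open in print for a general K3 surface) and the marking fact;
no definition, no new named fact, no sorry; nothing here says HC or the crux is proved. Prover seat
hodge-nonav-19652-p1 (gen 15), `--supports stmt-HodgeConjecture-13676`.

References: M. Varesco, Math. Z. 305 (2023), §0.3 Thm. 3, Thm. 5.3, §2; D. Huybrechts, Comment. Math.
Helv. 94 (2019), §1; N. Buskin, J. reine angew. Math. 755 (2019), §6.2; W. Fulton, *Intersection Theory*, §16.1.
-/

set_option linter.dupNamespace false

noncomputable section

open CategoryTheory MonoidalCategory SemiCartesianMonoidalCategory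
open scoped Manifold TensorProduct
open Literature.AlgebraicGeometry Literature.AlgebraicGeometry.Motives Literature.AlgebraicGeometry.HodgeTheory
open Literature.AlgebraicGeometry.Surfaces Literature.Geometry.Kaehler
open Literature.AlgebraicTopology.SingularHomology
open Summit.HodgeConjecture.HodgeConjecture.Theses.NikulinTwinTransport
open Summit.HodgeConjecture.HodgeConjecture.Theorems.MarkmanPartnerTransport
open Summit.HodgeConjecture.HodgeConjecture.Theorems.OddPrimeSquares
open Summit.HodgeConjecture.HodgeConjecture.Ring2.AbelianAll

namespace Summit.HodgeConjecture.HodgeConjecture.Theorems.NikulinTwinTransport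

/-! ### Local notations (verbatim those of `…HodgeSimilitudeAlgebraicTranscendental`) -/

/-- `MarkedK3[S, η, p, x]`: a marked K3 surface with period `x`. Local notation only. -/
local notation3 (prettyPrint := false) "MarkedK3[" S ", " η ", " p ", " x "]" =>
  (IsIntegralClass p ∧
    (∀ q : complexBetti S (2 * 2), IsIntegralClass q → ∃ n : ℤ, q = n • p) ∧
    (∀ c : complexBetti S (2 * 1), IsIntegralClass c ↔ ∃ v : K3Index → ℤ, η c = fun i => (v i : ℂ)) ∧
    (∀ a b : complexBetti S (2 * 1),
        cupProduct (rfl : 2 * 1 + 2 * 1 = 2 * 2) a b = k3Form (η a) (η b) • p) ∧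
    IsOfHodgeType 2 S (2 * 1) 2 0 (LinearEquiv.symm η x) ∧
    (∀ τ : complexBetti S (2 * 1), IsOfHodgeType 2 S (2 * 1) 2 0 τ → ∃ t : ℂ, τ = t • LinearEquiv.symm η x))

/-- `PeriodPt[x]`: a projective period point. Local notation only. -/
local notation3 (prettyPrint := false) "PeriodPt[" x "]" =>
  (k3Form x x = 0 ∧ 0 < (k3Form (star x) x).re ∧
    ∃ u : K3Index → ℤ, k3Form (fun i => (u i : ℂ)) x = 0 ∧ 0 < ∑ i, ∑ j, u i * k3Gram i j * u j)

/-- `Corr[μ, S, S', hS, hS' ; γ, y] = [γ]_* y`. Local notation only. -/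
local notation3 (prettyPrint := false) "Corr[" μ ", " S ", " S' ", " hS ", " hS' " ; " γ ", " y "]" =>
  complexGysin μ
    (IsSmoothProjective.tensor_holds (IsK3Surface.isSmoothProjective hS)
      (IsK3Surface.isSmoothProjective hS'))
    (IsK3Surface.isSmoothProjective hS) (SemiCartesianMonoidalCategory.fst S S')
    (rfl : 2 * 1 + 2 * 2 + 2 * 2 = 2 * 1 + 2 * (2 + 2))
    (cupProduct (rfl : 2 * 1 + 2 * 2 = 2 * 1 + 2 * 2)
      (complexBetti.map (SemiCartesianMonoidalCategory.snd S S') (2 * 1) y) γ)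

/-- `TransTwinTransportFor[M]`: the TRANSCENDENTAL twin transport for `M`. Local notation only. -/
local notation3 (prettyPrint := false) "TransTwinTransportFor[" M "]" =>
  ∀ (μ : OrientationFamily), μ.HasPoincareDuality →
    ∀ (S S' : SchemeOver ℂ) (hS : IsK3Surface S) (hS' : IsK3Surface S')
      (η : complexBetti S (2 * 1) ≃ₗ[ℂ] (K3Index → ℂ)) (p : complexBetti S (2 * 2))
      (x : K3Index → ℂ)
      (η' : complexBetti S' (2 * 1) ≃ₗ[ℂ] (K3Index → ℂ)) (p' : complexBetti S' (2 * 2))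
      (x' : K3Index → ℂ),
      MarkedK3[S, η, p, x] → PeriodPt[x] → MarkedK3[S', η', p', x'] → PeriodPt[x'] →
      (∃ t : ℂ, M x' = t • x) →
      ∃ γ ∈ algebraicClasses (MonoidalCategoryStruct.tensorObj S S') 2,
        (∀ d' ∈ algebraicClasses S' 1, Corr[μ, S, S', hS, hS' ; γ, d'] ∈ algebraicClasses S 1) ∧
        ∀ y : complexBetti S' (2 * 1),
          (∀ d' ∈ algebraicClasses S' 1, cupProduct (rfl : 2 * 1 + 2 * 1 = 2 * 2) y d' = 0) →
          η.symm (M (η' y)) = Corr[μ, S, S', hS, hS' ; γ, y]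

/-- `RatTransTwinTransportAt[c]`: TRANSCENDENTAL twin transport for every rational `c`-similitude of
`Λ_ℂ` with rational two-sided inverse. Local notation only. -/
local notation3 (prettyPrint := false) "RatTransTwinTransportAt[" c "]" =>
  ∀ (M N : Module.End ℂ (K3Index → ℂ)),
    (∀ v : K3Index → ℤ, ∃ w : K3Index → ℚ, M (fun i => (v i : ℂ)) = fun i => (w i : ℂ)) →
    (∀ v : K3Index → ℤ, ∃ w : K3Index → ℚ, N (fun i => (v i : ℂ)) = fun i => (w i : ℂ)) →
    M * N = 1 → N * M = 1 → (∀ a b, k3Form (M a) (M b) = c * k3Form a b) → TransTwinTransportFor[M]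

/-- `Transc[S, y]`: `y` is cup-orthogonal to `N¹(S)`. Local notation only. -/
local notation3 (prettyPrint := false) "Transc[" S ", " y "]" =>
  (∀ d ∈ algebraicClasses S 1, cupProduct (rfl : 2 * 1 + 2 * 1 = 2 * 2) y d = 0)

/-! ### §1 Algebraic correspondences between two surfaces in the `[γ]_*` spelling, any orientation family -/

/-- **An algebraic correspondence `H²(S′) → H²(S)` between smooth projective surfaces is `[γ]_*` for an
algebraic class `γ` on `S ⊗ S′` and ANY orientation family `μ`** (the orientations witnessing
`IsAlgebraicCorrespondence` differ from `μ` by units on the connected closed manifolds `(S ⊗ S′)(ℂ)`,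
`S(ℂ)`, so the Gysin maps differ by a non-zero scalar; rescale `γ`).
[cite: FultonYoungTableaux1997, Appendix B §B.1 (5)] [cite: HatcherAT2002, §3.3 Thm. 3.26] -/
theorem exists_corr_of_isAlgebraicCorrespondence₂ (μ : OrientationFamily) {S S' : SchemeOver ℂ}
    (hS : IsSmoothProjective 2 S) (hS' : IsSmoothProjective 2 S')
    {T : complexBetti S' (2 * 1) →ₗ[ℂ] complexBetti S (2 * 1)} (hT : IsAlgebraicCorrespondence 2 2 S S' T) :
    ∃ γ ∈ algebraicClasses (S ⊗ S') 2, ∀ y : complexBetti S' (2 * 1),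
      T y = complexGysin μ (IsSmoothProjective.tensor_holds hS hS') hS (SemiCartesianMonoidalCategory.fst S S')
        (rfl : 2 * 1 + 2 * 2 + 2 * 2 = 2 * 1 + 2 * (2 + 2))
        (cupProduct (rfl : 2 * 1 + 2 * 2 = 2 * 1 + 2 * 2)
          (complexBetti.map (SemiCartesianMonoidalCategory.snd S S') (2 * 1) y) γ) := by
  obtain ⟨μ₀, ν₀, hμ₀, hν₀, e, q, hab, hq, γ₀, hγ₀, hTeq⟩ := hT
  obtain rfl : e = 2 := by omega
  obtain rfl : q = 2 := by omega
  have hSS : IsSmoothProjective (2 + 2) (S ⊗ S') := IsSmoothProjective.tensor_holds hS hS'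
  letI := hS.chartedSpace
  letI := hSS.chartedSpace
  haveI := Motives.ComplexPoints.compactSpace_of_isSmoothProjective hS
  haveI := Motives.ComplexPoints.t2Space_of_isSmoothProjective hS
  haveI := connectedSpace_complexPoints hS
  haveI := Motives.ComplexPoints.compactSpace_of_isSmoothProjective hSS
  haveI := Motives.ComplexPoints.t2Space_of_isSmoothProjective hSS
  haveI := connectedSpace_complexPoints hSS
  obtain ⟨uY, huY, -⟩ := (μ hSS).exists_unit_fundamentalClass_eq_smul μ₀
  obtain ⟨uX, huX, -⟩ := (μ hS).exists_unit_fundamentalClass_eq_smul ν₀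
  have key : gysinMap μ₀ ν₀ (Motives.AlgPoints.mapContinuous (L := ℂ) (fst S S'))
      (show 2 * 1 + 2 * 2 + 2 = 2 * (2 + 2) by omega) hq =
      (((uX : ℂ))⁻¹ * (uY : ℂ)) • gysinMap (μ hSS) (μ hS) (Motives.AlgPoints.mapContinuous (L := ℂ) (fst S S'))
        (show 2 * 1 + 2 * 2 + 2 = 2 * (2 + 2) by omega) hq :=
    gysinMap_eq_smul_of_fundamentalClass_eq (OrientationFamily.hasPoincareDuality μ hS) hν₀ huY huX
      (by rw [← mul_assoc, mul_inv_cancel₀ (Units.ne_zero uX), one_mul]) _ _ _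
  refine ⟨(((uX : ℂ))⁻¹ * (uY : ℂ)) • γ₀, Submodule.smul_mem _ _ hγ₀, fun y ↦ ?_⟩
  rw [← LinearMap.congr_fun hTeq y, corrClassAction_apply, key, LinearMap.smul_apply,
    map_smul, map_smul,
    complexGysin_eq_gysinMap hSS hS (fst S S') (rfl : 2 * 1 + 2 * 2 + 2 * 2 = 2 * 1 + 2 * (2 + 2))
      (show 2 * 1 + 2 * 2 + 2 = 2 * (2 + 2) by omega) hq]

/-! ### §2 Twin similitudes carry transcendental classes to transcendental classes -/

section Twin

variable {S S' : SchemeOver ℂ} {η : complexBetti S (2 * 1) ≃ₗ[ℂ] (K3Index → ℂ)} {p : complexBetti S (2 * 2)}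
  {x : K3Index → ℂ} {η' : complexBetti S' (2 * 1) ≃ₗ[ℂ] (K3Index → ℂ)} {p' : complexBetti S' (2 * 2)}
  {x' : K3Index → ℂ}

/-- The inverse of a rational `c`-similitude carrying `x′` into `ℂx` is a `c⁻¹`-similitude carrying `x`
into `ℂx′` (multiplier `≠ 0`, `x′ ≠ 0`). [folklore] -/
theorem inverse_similitude_data (hx' : 0 < (k3Form (star x') x').re) {M N : Module.End ℂ (K3Index → ℂ)}
    (hMN : M * N = 1) (hNM : N * M = 1) {c : ℂ} (hc : c ≠ 0) (hM : ∀ a b, k3Form (M a) (M b) = c * k3Form a b)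
    (hper : ∃ t : ℂ, M x' = t • x) :
    (∀ a b, k3Form (N a) (N b) = c⁻¹ * k3Form a b) ∧ ∃ t : ℂ, N x = t • x' := by
  refine ⟨fun a b => ?_, ?_⟩
  · have h := hM (N a) (N b)
    rw [← Module.End.mul_apply, ← Module.End.mul_apply, hMN, Module.End.one_apply, Module.End.one_apply] at h
    rw [h, ← mul_assoc, inv_mul_cancel₀ hc, one_mul]
  · obtain ⟨t, ht⟩ := hper
    have ht0 : t ≠ 0 := by
      rintro rfl
      rw [zero_smul] at ht
      apply ne_zero_of_star_self_re_pos hx'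
      have h := congrArg N ht
      rwa [map_zero, ← Module.End.mul_apply, hNM, Module.End.one_apply] at h
    refine ⟨t⁻¹, ?_⟩
    have h := congrArg N ht
    rw [← Module.End.mul_apply, hNM, Module.End.one_apply, map_smul] at h
    rw [h, smul_smul, inv_mul_cancel₀ ht0, one_smul]

/-- **A twin similitude carries `T(S′)` into `T(S)`**: for marked projective K3 surfaces `(S, η, p, x)`,
`(S′, η′, p′, x′)` and a rational similitude `M` of `Λ_ℂ` with rational inverse `N`, non-zero multiplier
and `M x′ ∈ ℂ x`, the map `ψ = η⁻¹ ∘ M ∘ η′` sends classes cup-orthogonal to `N¹H²(S′)` to classes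
cup-orthogonal to `N¹H²(S)`: every `d ∈ N¹H²(S)` is `ψ(w)` with `w = η′⁻¹ N η d ∈ N¹H²(S′)` (the inverse
twin similitude carries divisor classes to divisor classes, `markingConj_mem_algebraicClasses`), and
`ψy ∪ ψw = c (y ∪ w)`-scaled `= 0`. [cite: Huybrechts2019, §1] [cite: Varesco2023, §2] -/
theorem transc_markingConj (hS : IsK3Surface S) (hS' : IsK3Surface S')
    (hm : MarkedK3[S, η, p, x]) (hx : PeriodPt[x]) (hm' : MarkedK3[S', η', p', x']) (hx' : PeriodPt[x'])
    {M N : Module.End ℂ (K3Index → ℂ)}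
    (hNrat : ∀ v : K3Index → ℤ, ∃ w : K3Index → ℚ, N (fun i => (v i : ℂ)) = fun i => (w i : ℂ))
    (hMN : M * N = 1) (hNM : N * M = 1) {c : ℂ} (hc : c ≠ 0) (hM : ∀ a b, k3Form (M a) (M b) = c * k3Form a b)
    (hper : ∃ t : ℂ, M x' = t • x) {y : complexBetti S' (2 * 1)} (hy : Transc[S', y]) :
    Transc[S, η.symm (M (η' y))] := by
  intro d hd
  have hp0 : p ≠ 0 := generator_ne_zero hS hm.2.1
  have hp'0 : p' ≠ 0 := generator_ne_zero hS' hm'.2.1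
  obtain ⟨hN, hperN⟩ := inverse_similitude_data hx'.2.1 hMN hNM hc hM hper
  -- `w = ψ⁻¹ d ∈ N¹H²(S')`
  set w : complexBetti S' (2 * 1) := η'.symm (N (η d)) with hw
  have hwN : w ∈ algebraicClasses S' 1 :=
    markingConj_mem_algebraicClasses Huybrechts_K3_hodgeTypes_H2_holds algebraicClassesOneOneK3_proof
      lefschetzOneOneK3_proof hS' hS hm' hx' hm hx N hNrat (inv_ne_zero hc) hN hperN hd
  have hdw : d = η.symm (M (η' w)) := by
    rw [hw, η'.apply_symm_apply, ← Module.End.mul_apply, hMN, Module.End.one_apply, η.symm_apply_apply]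
  have h0 : cupProduct (rfl : 2 * 1 + 2 * 1 = 2 * 2) y w = (0 : ℂ) • p' := by rw [zero_smul]; exact hy w hwN
  rw [hdw, cupProduct_markingConj η p η' p' M hp'0 hm.2.2.2.1 hm'.2.2.2.1 hM y w 0 h0, mul_zero, zero_smul]

end Twin

/-! ### §3 Transcendental twin transport from Kuga–Satake -/

/-- **Granted the Kuga–Satake statement for every projective K3 surface, transcendental twin transport
holds at every rational multiplier `c > 0`.** For a rational `c`-similitude `M` of `Λ_ℂ` (rational
inverse `N`) and an `M`-twin pair of marked projective K3 surfaces, `ψ = η⁻¹ ∘ M ∘ η′` is rational,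
type-preserving, maps `T(S′)_ℂ` bijectively onto `T(S)_ℂ` and multiplies the intersection forms by
`c ∫p / ∫p′` there; composed with the rational transcendental projector `Q′` of `S′` it satisfies the
hypotheses of the two-surface Kuga–Satake theorem, so some algebraic correspondence `Φ` agrees with `ψ`
on `T(S′)`; `Φ = [γ]_*` for the given orientation family (`exists_corr_of_isAlgebraicCorrespondence₂`) and
`[γ]_*` carries `N¹H²(S′)` into `N¹H²(S)` (it is a `ℂ`-combination of rational algebraic
correspondences). CONDITIONAL on Kuga–Satake. [cite: Varesco2023, §0.3 Thm. 3 and Thm. 5.3]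
[cite: Huybrechts2019, §1] -/
theorem ratTransTwinTransportAt_of_kugaSatake
    (hKS : ∀ (S : SchemeOver ℂ) (hS : IsK3Surface S), IsKSCorrespondenceAlgebraicBetti hS.isSmoothProjective)
    (c : ℚ) (hc : 0 < c) : RatTransTwinTransportAt[((c : ℚ) : ℂ)] := by
  intro M N hMrat hNrat hMN hNM hM μ hμ S S' hS hS' η p x η' p' x' hm hx hm' hx' hper
  classical
  have hX := hS.isSmoothProjective
  have hX' := hS'.isSmoothProjective
  have hc0 : ((c : ℚ) : ℂ) ≠ 0 := by exact_mod_cast hc.ne'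
  have hp0 : p ≠ 0 := generator_ne_zero hS hm.2.1
  have hp'0 : p' ≠ 0 := generator_ne_zero hS' hm'.2.1
  obtain ⟨hN, hperN⟩ := inverse_similitude_data hx'.2.1 hMN hNM hc0 hM hper
  -- the `(2,0)`-lines
  have hσ0 : η.symm x ≠ 0 := fun h0 => ne_zero_of_star_self_re_pos hx.2.1 (by simpa using congrArg η h0)
  have hσ'0 : η'.symm x' ≠ 0 := fun h0 => ne_zero_of_star_self_re_pos hx'.2.1 (by simpa using congrArg η' h0)
  -- `ψ` and its properties
  set ψ : complexBetti S' (2 * 1) →ₗ[ℂ] complexBetti S (2 * 1) :=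
    η.symm.toLinearMap ∘ₗ M ∘ₗ η'.toLinearMap with hψdef
  have hψ : ∀ y, ψ y = η.symm (M (η' y)) := fun _ => rfl
  have h1 : ∀ y, IsRationalClass y → IsRationalClass (ψ y) := fun y hy => by
    rw [hψ]; exact isRationalClass_markingConj η η' M hS hS' hm.2.2.1 hm'.2.2.1 hMrat hy
  have h2 : ∀ (i j : ℕ) y, IsOfHodgeType 2 S' (2 * 1) i j y → IsOfHodgeType 2 S (2 * 1) i j (ψ y) :=
    fun i j y hy => by
      rw [hψ]
      exact isOfHodgeType_markingConj η p x η' p' x' M Huybrechts_K3_hodgeTypes_H2_holds hS hS' hm.2.2.1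
        hm.2.2.2.1 hm.2.2.2.2.1 hx.2.1 hm'.2.2.1 hm'.2.2.2.1 hp'0 hm'.2.2.2.2.1 hx'.2.1 hMrat hc0 hM hper i j y hy
  have hT : ∀ y, Transc[S', y] → Transc[S, ψ y] := fun y hy => by
    rw [hψ]; exact transc_markingConj hS hS' hm hx hm' hx' hNrat hMN hNM hc0 hM hper hy
  -- the inverse twin similitude
  have hT' : ∀ z, Transc[S, z] → Transc[S', η'.symm (N (η z))] := fun z hz =>
    transc_markingConj hS' hS hm' hx' hm hx hMrat hNM hMN (inv_ne_zero hc0) hN hperN hz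
  have hψinv : ∀ z, ψ (η'.symm (N (η z))) = z := fun z => by
    rw [hψ, η'.apply_symm_apply, ← Module.End.mul_apply, hMN, Module.End.one_apply, η.symm_apply_apply]
  have hinvψ : ∀ y, η'.symm (N (η (ψ y))) = y := fun y => by
    rw [hψ, η.apply_symm_apply, ← Module.End.mul_apply, hNM, Module.End.one_apply, η'.symm_apply_apply]
  -- WLOG through the transcendental projector of `S'`
  obtain ⟨Q, hQrat, hQtyp, hQT, hQid⟩ :=
    KugaSatakePair.exists_rational_transcendentalProjector hX' hm'.2.2.2.2.1 hσ'0 hm'.2.2.2.2.2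
  set ψ₁ := ψ ∘ₗ Q with hψ₁
  have hψ₁T : ∀ y, Transc[S', y] → ψ₁ y = ψ y := fun y hy => by rw [hψ₁, LinearMap.comp_apply, hQid y hy]
  have h1' : ∀ y, IsRationalClass y → IsRationalClass (ψ₁ y) := fun y hy => h1 _ (hQrat y hy)
  have h2' : ∀ (i j : ℕ) y, IsOfHodgeType 2 S' (2 * 1) i j y → IsOfHodgeType 2 S (2 * 1) i j (ψ₁ y) :=
    fun i j y hy => h2 i j _ (hQtyp i j y hy)
  have h4' : ∀ y, Transc[S, ψ₁ y] := fun y => hT _ (hQT y)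
  have hinj : ∀ y, Transc[S', y] → ψ₁ y = 0 → y = 0 := by
    intro y hy h0
    rw [hψ₁T y hy] at h0
    rw [← hinvψ y, h0, map_zero, map_zero, map_zero]
  have hsurj : ∀ z, Transc[S, z] → ∃ y, Transc[S', y] ∧ ψ₁ y = z := fun z hz =>
    ⟨η'.symm (N (η z)), hT' z hz, by rw [hψ₁T _ (hT' z hz), hψinv]⟩
  -- the multiplier through the markings
  have hmul : ∀ y w : complexBetti S' (2 * 1), Transc[S', y] → Transc[S', w] →
      traceC hX (cupProduct (rfl : 2 * 1 + 2 * 1 = 2 * 2) (ψ₁ y) (ψ₁ w)) =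
        (((c : ℚ) : ℂ) * traceC hX p * (traceC hX' p')⁻¹) *
          traceC hX' (cupProduct (rfl : 2 * 1 + 2 * 1 = 2 * 2) y w) := by
    intro y w hy hw
    have hτ' : traceC hX' p' ≠ 0 := fun h0 => hp'0 (eq_zero_of_traceC_eq_zero hX' h0)
    rw [hψ₁T y hy, hψ₁T w hw, hψ, hψ, hm.2.2.2.1, η.apply_symm_apply, η.apply_symm_apply, hM, hm'.2.2.2.1,
      map_smul, map_smul, smul_eq_mul, smul_eq_mul]
    field_simp
  have hμ0 : (((c : ℚ) : ℂ) * traceC hX p * (traceC hX' p')⁻¹) ≠ 0 :=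
    mul_ne_zero (mul_ne_zero hc0 (fun h0 => hp0 (eq_zero_of_traceC_eq_zero hX h0)))
      (inv_ne_zero (fun h0 => hp'0 (eq_zero_of_traceC_eq_zero hX' h0)))
  -- the two-surface Kuga–Satake theorem
  obtain ⟨Φ, hΦ, hΦψ⟩ := KugaSatakePair.exists_algebraicCorrespondence_eq_of_similitude_of_kugaSatake₂ hX' hX
    hm'.2.2.2.2.1 hσ'0 hm'.2.2.2.2.2 hm.2.2.2.2.1 hσ0 hm.2.2.2.2.2 (hKS S' hS') (hKS S hS) ψ₁ h1' h2' h4'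
    hinj hsurj hμ0 hmul
  -- in the `[γ]_*` spelling for `μ`
  obtain ⟨γ, hγ, hΦγ⟩ := exists_corr_of_isAlgebraicCorrespondence₂ μ hX hX' hΦ
  refine ⟨γ, hγ, fun d' hd' => ?_, fun y hy => ?_⟩
  · -- `[γ]_*` carries `N¹H²(S')` into `N¹H²(S)`
    rw [← hΦγ d']
    obtain ⟨e, hab, γ₀, hγ₀, hΦ₀⟩ := IsAlgebraicCorrespondence.exists_eq_corrAction hX hX' hΦ
    rw [hΦ₀]
    rw [← map_hodgeClasses_baseChange_eq_algebraicClasses hX'] at hd'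
    obtain ⟨u, hu, rfl⟩ := hd'
    obtain ⟨u', rfl⟩ := hu
    induction u' using TensorProduct.induction_on with
    | zero => rw [map_zero, map_zero, map_zero]; exact Submodule.zero_mem _
    | tmul a n =>
      rw [LinearMap.baseChange_tmul, Submodule.subtype_apply, ofRatClassBaseChange_tmul, map_smul]
      exact Submodule.smul_mem _ a (KugaSatakePair.corrAction_ofRatClass_mem_algebraicClasses₂ hX hX' hab hγ₀ n.2)
    | add x y hx hy => rw [map_add, map_add, map_add]; exact Submodule.add_mem _ hx hy
  · rw [← hψ, ← hψ₁T y hy, ← hΦψ y hy, hΦγ y]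

/-! ### §4 The crux and the target of route NikulinTwinTransport, granted Kuga–Satake -/

/-- **THE CRUX `HodgeSimilitudeAlgebraic` (stmt-HodgeConjecture-13676: every rational Hodge similitude of
positive rational multiplier between `H²` of projective K3 surfaces is algebraic), GRANTED the Kuga–Satake
statement for every projective K3 surface**, modulo the marking fact `Huybrechts_K3_marking_exists`
(Varesco 2023 §0.3: "all multipliers, under the Kuga–Satake Hodge conjecture" — now by name, with
Varesco's theorem proved in the tree). CONDITIONAL; credits nothing to HC or to the crux unconditionally.
[cite: Varesco2023, §0.3 Thm. 3 and Thm. 5.3] [cite: Huybrechts2019, §1] -/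
theorem hodgeSimilitudeAlgebraic_of_kugaSatake (hMk : Huybrechts_K3_marking_exists)
    (hKS : ∀ (S : SchemeOver ℂ) (hS : IsK3Surface S), IsKSCorrespondenceAlgebraicBetti hS.isSmoothProjective) :
    HodgeSimilitudeAlgebraic :=
  hodgeSimilitudeAlgebraic_of_forall_ratTransTwinTransportAt hMk Huybrechts_K3_hodgeTypes_H2_holds
    (fun X => hodgeIndex_surface_holds (X := X)) algebraicClassesOneOneK3_proof lefschetzOneOneK3_proof
    (fun c hc => ratTransTwinTransportAt_of_kugaSatake hKS c hc)

/-- **The target X `TwinSimilitudeAlgebraic` (stmt-HodgeConjecture-13674: rational Hodge `2`-similitudes of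
projective K3 surfaces are algebraic), GRANTED Kuga–Satake for every projective K3 surface**, modulo the
marking fact. CONDITIONAL. [cite: Varesco2023, §0.3 Thm. 3 and Thm. 5.3] -/
theorem twinSimilitudeAlgebraic_of_kugaSatake (hMk : Huybrechts_K3_marking_exists)
    (hKS : ∀ (S : SchemeOver ℂ) (hS : IsK3Surface S), IsKSCorrespondenceAlgebraicBetti hS.isSmoothProjective) :
    TwinSimilitudeAlgebraic :=
  twinSimilitudeAlgebraic_of_ratTransTwinTransportAt_two hMk Huybrechts_K3_hodgeTypes_H2_holds
    (fun X => hodgeIndex_surface_holds (X := X)) algebraicClassesOneOneK3_proof lefschetzOneOneK3_proof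
    (by exact_mod_cast ratTransTwinTransportAt_of_kugaSatake hKS 2 two_pos)

/-- **Buskin's item `HodgeIsometryAlgebraic` (stmt-HodgeConjecture-13675: rational Hodge ISOMETRIES of `H²`
of projective K3 surfaces are algebraic), GRANTED Kuga–Satake for every projective K3 surface** — the
multiplier-`1` case, modulo the marking fact (Buskin's theorem itself is NOT used: on the Kuga–Satake
branch the tree now proves the isometry case from the Kuga–Satake statements alone). CONDITIONAL.
[cite: Varesco2023, §0.3 Thm. 3 and Thm. 5.3] [cite: Buskin2019, Thm. 1.1] -/
theorem hodgeIsometryAlgebraic_of_kugaSatake (hMk : Huybrechts_K3_marking_exists)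
    (hKS : ∀ (S : SchemeOver ℂ) (hS : IsK3Surface S), IsKSCorrespondenceAlgebraicBetti hS.isSmoothProjective) :
    HodgeIsometryAlgebraic :=
  (hodgeIsometryAlgebraic_iff_ratTwinTransportAt_one hMk Huybrechts_K3_hodgeTypes_H2_holds).2
    (ratTwinTransportAt_of_trans Huybrechts_K3_hodgeTypes_H2_holds (fun X => hodgeIndex_surface_holds (X := X))
      algebraicClassesOneOneK3_proof lefschetzOneOneK3_proof 1 one_ne_zero
      (by exact_mod_cast ratTransTwinTransportAt_of_kugaSatake hKS 1 one_pos))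

end Summit.HodgeConjecture.HodgeConjecture.Theorems.NikulinTwinTransport

end
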